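/-
Copyright (c) 2026 the pub-hodgecm-mathlib formalisation cell (harness21).  Prover seat hodgecm-mathlib-LH7-p04 (g13): line LH7 hand on the LH4 dyadic chain (D-UNR),
brick (P-L)-dy «LEVI ROW 2-FREE», FILE L3 «(O2) AT ANY RESIDUE CHARACTERISTIC»; 2026-09-03.
-/
import Literature.NumberTheory.Automorphic.TorusDeepOrbitalIntegralStrata             -- ★ (O2) (F0P3a-p04 (g17), p846544): `classOrbitalIntegral_eq_mul_of_level_frame_of_integral_eq` (§2 socket), `apply_symm_torus_mul_eq_piece_rank` (§3, 2-free); brings ★ FILE D, ★ FILE C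
import Literature.NumberTheory.Automorphic.HeisenbergStrataMeasureUnramifiedAll        -- ★ FILE L2b (this seat): `integral_eq_of_eq_piece_rank_anyChar` (the rank-piece integral over `N` with `h2w` DELETED)
import HarnessLib

/-!
# The canonical orbital integral of a `K`-class piece at a deep split-torus class — the residual-rank instance at ANY residue characteristic

Topic `NumberTheory/Automorphic`; namespace `Literature.NumberTheory.Automorphic.UnitaryGroup`.  KERNEL mathematics only: one theorem, no definition, no named fact, no instance,
no notation, no `sorry`.  Cell `pub/hodgecm-mathlib` (D-0151), crux H413 = `stmt-HodgeConjecture-24833`, half A line LH4 (dyadic pay-down of `stub_N6nsDyadic`, organ (D-UNR)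
`stub_DyUnramCore`), brick **(P-L)-dy «THE LEVI ROW 2-FREE»**, FILE L3 (seat LH7-p04 (g13)): the `h2`-FREE twin of ★ (O2) `classOrbitalIntegral_eq_mul_rankStrata_of_torus_deep`
(`TorusDeepOrbitalIntegralStrata` §3) — the statement VERBATIM with the binder `(h2 : IsUnit (2 : 𝒪_w))` DELETED.  ★ (O2)'s proof reads `h2` exactly once, as `h2w : |2|_w = 1`
for ★ FILE C `integral_eq_of_eq_piece_rank`; here that call is ★ FILE L2b `integral_eq_of_eq_piece_rank_anyChar` (the same volumes through the sheared chart of ★ FILE L1∕L2a),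
every other line is ★ (O2)'s (§2 socket ★ `classOrbitalIntegral_eq_mul_of_level_frame_of_integral_eq`, §3 instance ★ `apply_symm_torus_mul_eq_piece_rank`, both 2-free).
Consumer: FILE L4, the `h2`-free Levi clause `depthZeroKappaTransfer_hyperspecial_levi_of_isUnramifiedIn`.  HONEST LABEL: HC_CM is proved only modulo the 7 printed citations
(2 remaining named inputs: hLiu418 = stmt-HodgeConjecture-24832, h413 = stmt-HodgeConjecture-24833) until rung 0 closes; count-neutral, discharges nothing.

THE MATHEMATICS ([Rogawski1990] §4.9 pp. 54–56, Prop. 4.9.1; [Flicker1998UnitaryFL] §2).  `L` CM, `v` non-split and UNRAMIFIED in `L` (any residue characteristic), `G′_v = U(H)(L⁺_v)`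
with hyperspecial `K′`, `ψ : G′_v ≃ U(Φ₃)(L⁺_v)` the level-preserving frame with `(ψ g)_w = T g_w T⁻¹`, `T ∈ GL₃(𝒪_w)`, `m_G` canonical, `t = diag(d)` REGULAR and DEEP, `ψ γ₀ = t`,
`g` a depth-zero piece (`hg hgK hginv hc`).  Then **`Φ(⟦γ₀⟧, g) = ν_G(K′) · J₃(t) · q⁻³ · (c₀·1 + c₁·(q − 1) + c₂·(q³ − q))`**, `q = N𝔭_v`.

## References
* [Rogawski1990] J. D. Rogawski, *Automorphic Representations of Unitary Groups in Three Variables*, Ann. of Math. Stud. 123 (1990), §4.9 pp. 54–56 (Prop. 4.9.1), §4.3 (4.3.1) p. 43.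
* [Flicker1998UnitaryFL] Y. Z. Flicker, *Elementary proof of the fundamental lemma for a unitary group*, Canad. J. Math. 50 (1998), §2.
* [Kottwitz1986BaseChangeUnits] R. E. Kottwitz, *Base change for unit elements of Hecke algebras*, Compositio Math. 60 (1986), §1 pp. 240–241.
-/

set_option autoImplicit false

noncomputable section

open MeasureTheory Measure Set Filter Topology NumberField IsDedekindDomain
open Literature.MeasureTheory.Group
open scoped ENNReal NNReal Matrix MatrixGroups ValuativeRel

namespace Literature.NumberTheory.Automorphic.UnitaryGroup

open Literature.NumberTheory.Rogawski1990 (IsRegularElt)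
open Literature.NumberTheory.Automorphic Literature.NumberTheory.Automorphic.IntegralReduction

variable (L : Type) [Field L] [NumberField L] [IsCMField L] {v : HeightOneSpectrum (𝓞 ↥(maximalRealSubfield L))}
  (w : PlacesOver L v) (hw : IsCMField.complexConj L • w.1 = w.1)

set_option maxHeartbeats 1600000 in
-- instance-term unification on the CM local carriers (★ (O2)'s own budget, same statement shape)
include hw in
/-- **THE CANONICAL ORBITAL INTEGRAL OF A DEPTH-ZERO PIECE AT A DEEP REGULAR SPLIT-TORUS CLASS OF THE INNER FORM, ANY RESIDUE CHARACTERISTIC** (★ (O2) with `h2` DELETED).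
`v` non-split, UNRAMIFIED in `L`; `ψ` the level-preserving Jacobowitz frame with its `T ∈ GL₃(𝒪_w)`; `m_G` canonical; `t = diag(d) ∈ T` REGULAR and DEEP, `ψ γ₀ = t`; `g ∈ C_c^∞(U(H)(L⁺_v))`
supported in `K′`, `Ad K′`-invariant, `= c r` on the residually-unipotent Jordan stratum `r` of `K′`.  Then
**`classOrbitalIntegral m_G g ⟦γ₀⟧ = ν_G(K′) · J₃(t) · q⁻³ · (c₀·1 + c₁·(q − 1) + c₂·(q³ − q))`**, `q = N𝔭_v`
(★ §2 socket ∘ ★ `apply_symm_torus_mul_eq_piece_rank` ∘ ★ FILE L2b `integral_eq_of_eq_piece_rank_anyChar`). [cite: Rogawski1990, §4.9 Prop. 4.9.1 pp. 54–56; §4.3 (4.3.1) p. 43]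
[cite: Flicker1998UnitaryFL, §2] [cite: Kottwitz1986BaseChangeUnits, §1 pp. 240–241] -/
theorem classOrbitalIntegral_eq_mul_rankStrata_of_torus_deep_anyChar (H : Matrix (Fin 3) (Fin 3) L)
    (hH : (H.map (IsCMField.complexConj L))ᵀ = H) (hHd : IsUnit H.det)
    (hv : Algebra.IsUnramifiedIn (𝓞 L) v.asIdeal)
    [MeasurableSpace ((cmDatum L 3 H).Local v)] [BorelSpace ((cmDatum L 3 H).Local v)]
    [∀ γ : (cmDatum L 3 H).Local v, MeasurableSpace (((cmDatum L 3 H).Local v) ⧸ Subgroup.centralizer ({γ} : Set ((cmDatum L 3 H).Local v)))]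
    [∀ γ : (cmDatum L 3 H).Local v, BorelSpace (((cmDatum L 3 H).Local v) ⧸ Subgroup.centralizer ({γ} : Set ((cmDatum L 3 H).Local v)))]
    (νG : Measure ((cmDatum L 3 H).Local v)) [νG.IsHaarMeasure] [νG.IsMulRightInvariant]
    {mG : OrbitalMeasureFamily ((cmDatum L 3 H).Local v)}
    (hmG : mG.IsCanonical (fun γ => IsRegularElt (γ.val : GL (Fin 3) (LocalRing L v))) νG)
    [MeasurableSpace ↥(unitaryGroupOfForm (conjLocal L (IsCMField.complexConj L) v) (cmLocalForm L 3 v))]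
    [BorelSpace ↥(unitaryGroupOfForm (conjLocal L (IsCMField.complexConj L) v) (cmLocalForm L 3 v))]
    (ψ : (cmDatum L 3 H).Local v ≃ₜ* ↥(unitaryGroupOfForm (conjLocal L (IsCMField.complexConj L) v) (cmLocalForm L 3 v)))
    (hψK : ∀ g : (cmDatum L 3 H).Local v, ψ g ∈ cmLocalIntegralLevel L 3 (Matrix.of fun i j : Fin 3 => if i.val + j.val + 1 = 3 then (1 : L) else 0) v ↔
      g ∈ cmLocalIntegralLevel L 3 H v)
    (hψc : ∀ g : (cmDatum L 3 H).Local v, IsConj (g.val : GL (Fin 3) (LocalRing L v))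
      ((ψ g : ↥(unitaryGroupOfForm (conjLocal L (IsCMField.complexConj L) v) (cmLocalForm L 3 v))) : GL (Fin 3) (LocalRing L v)))
    (T : GL (Fin 3) (w.1.adicCompletion L)) (hT : T ∈ glInt 3 (w.1.adicCompletion L))
    (hψT : ∀ g : (cmDatum L 3 H).Local v, localGLPiEquiv L 3 v
        (((ψ g : ↥(unitaryGroupOfForm (conjLocal L (IsCMField.complexConj L) v) (cmLocalForm L 3 v))) : GL (Fin 3) (LocalRing L v))) w =
      T * localGLPiEquiv L 3 v (g.val : GL (Fin 3) (LocalRing L v)) w * T⁻¹)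
    (t : ↥(torusU (conjLocal L (IsCMField.complexConj L) v) (cmLocalForm L 3 v))) {d : Fin 3 → (LocalRing L v)ˣ}
    (hd : glDiagonal 3 (LocalRing L v) d =
      ((t : ↥(unitaryGroupOfForm (conjLocal L (IsCMField.complexConj L) v) (cmLocalForm L 3 v))) : GL (Fin 3) (LocalRing L v)))
    (hreg : ∀ i j, i ≠ j → IsUnit ((d i : LocalRing L v) - d j))
    (ha' : IsUnit ((((d 0)⁻¹ * d 1 : (LocalRing L v)ˣ) : LocalRing L v) - 1))
    (hb' : IsUnit ((((d 0)⁻¹ * d 2 : (LocalRing L v)ˣ) : LocalRing L v) - 1))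
    (ht1 : ∀ i : Fin 3, Valued.v ((((d i : (LocalRing L v)ˣ) : LocalRing L v) w) - 1) < 1)
    {γ₀ : (cmDatum L 3 H).Local v} (hγ₀ : ψ γ₀ = (t : ↥(unitaryGroupOfForm (conjLocal L (IsCMField.complexConj L) v) (cmLocalForm L 3 v))))
    -- the depth-zero piece: HEAD v4's binders VERBATIM
    (g : ((cmDatum L 3 H).Local v) → ℂ) (hg : Literature.NumberTheory.Rogawski1990.IsLocSmooth g) (hgK : tsupport g ⊆ (cmLocalIntegralLevel L 3 H v : Set ((cmDatum L 3 H).Local v)))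
    (hginv : ∀ u ∈ cmLocalIntegralLevel L 3 H v, ∀ x, g (u * x * u⁻¹) = g x)
    (c : ℕ → ℂ)
    (hc : ∀ k ∈ cmLocalIntegralLevel L 3 H v,
      (redMat (((k.val : GL (Fin 3) (UnitaryGroup.LocalRing L v)).val.map (Pi.evalRingHom (fun w' : PlacesOver L v => w'.1.adicCompletion L) w))) - 1) ^ 3 = 0 →
      g k = c (redMat (((k.val : GL (Fin 3) (UnitaryGroup.LocalRing L v)).val.map (Pi.evalRingHom (fun w' : PlacesOver L v => w'.1.adicCompletion L) w))) - 1).rank) :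
    classOrbitalIntegral mG g (ConjClasses.mk γ₀) =
      (νG.real (cmLocalIntegralLevel L 3 H v : Set ((cmDatum L 3 H).Local v)) : ℂ) *
        (((letI : MeasurableSpace (LocalRing L v) := borel _; haveI : BorelSpace (LocalRing L v) := ⟨rfl⟩
          haveI : SecondCountableTopology (LocalRing L v) := secondCountableTopology_localRing (E := L) v
          ((distribHaarChar (LocalRing L v) ha'.unit)⁻¹ *
            (HeisRing.skewModulus (conjLocal L (IsCMField.complexConj L) v) (continuous_conjLocal L (IsCMField.complexConj L) v) hb'.unit
              (HeisRing.map_unit_torusCentralScalar_sub_one (conjLocal L (IsCMField.complexConj L) v) (cmLocalForm_eq_over L 3 v) t hd hb'))⁻¹ :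
                ℝ≥0)) : ℝ≥0) : ℂ) *
        ((((Ideal.absNorm v.asIdeal : ℂ)) ^ 3)⁻¹ *
          (c 0 * 1 + c 1 * ((Ideal.absNorm v.asIdeal : ℂ) - 1) + c 2 * ((Ideal.absNorm v.asIdeal : ℂ) ^ 3 - (Ideal.absNorm v.asIdeal : ℂ)))) := by
  -- a Haar measure on `N` (it cancels)
  haveI : LocallyCompactSpace ↥(unitaryGroupOfForm (conjLocal L (IsCMField.complexConj L) v) (cmLocalForm L 3 v)) :=
    locallyCompactSpace_local (IsCMField.complexConj L) 3 _ v
  haveI : LocallyCompactSpace ↥(unipotentU (conjLocal L (IsCMField.complexConj L) v) (cmLocalForm L 3 v)) :=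
    (isClosed_cmBorelTriple_N L v).isClosedEmbedding_subtypeVal.locallyCompactSpace
  obtain ⟨μN, hμN⟩ : ∃ μN : Measure ↥(unipotentU (conjLocal L (IsCMField.complexConj L) v) (cmLocalForm L 3 v)), μN.IsHaarMeasure :=
    ⟨Measure.haar, inferInstance⟩
  haveI := hμN
  -- ★ FILE L2b on the rank instance `F(n) = g(ψ⁻¹(t n))` (any residue characteristic)
  have hInt := integral_eq_of_eq_piece_rank_anyChar L v w hw μN hv c
    (fun n => g (ψ.symm ((t : ↥(unitaryGroupOfForm (conjLocal L (IsCMField.complexConj L) v) (cmLocalForm L 3 v))) *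
      (n : ↥(unitaryGroupOfForm (conjLocal L (IsCMField.complexConj L) v) (cmLocalForm L 3 v))))))
    (fun n => apply_symm_torus_mul_eq_piece_rank L w hw H ψ hψK T hT hψT t hd ht1 g hgK c hc n)
  exact classOrbitalIntegral_eq_mul_of_level_frame_of_integral_eq L H hH hHd w hw νG hmG ψ hψK hψc μN t hd hreg ha' hb' hγ₀ g
    hg.continuous.measurable hginv _ (fun _ => rfl) _ hInt

end Literature.NumberTheory.Automorphic.UnitaryGroup

end
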